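import Summits.Ventures.CertifiedManyBodySolver.Rows.SourcedTorusRowsHook
import Summits.Ventures.CertifiedManyBodySolver.Observables.PinningFieldChords
import Literature.MathematicalPhysics.QuantumLattice.GroundStateSectorAverage
import Literature.MathematicalPhysics.QuantumLattice.InfVolFermionStateHubbardEnergy
import Literature.MathematicalPhysics.QuantumLattice.TranslationInvariantGroundStates
import HarnessLib

/-!
# PINNING-FIELD rows: the one-point ground-state cell IS a floor / ceiling on the response `m_L(h)`
# (bridge `Rows/SourcedTorusRows` ⟶ `Observables/PinningFieldChords`)

HONEST FRAMING: first certified bounds on pairing observables; not a superconductivity verdict; every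
number certified (two lineages + referee) or labelled float. A response AT FIXED `h > 0` is
symmetry-allowed and says nothing about spontaneous order.

WHAT THIS FILE IS (cell hubbard-cq, D-0082 (c) / LADDER row PC-a, seat hubbard-cq-obsth-1 "pinning-field K5
menu nodes"). The K5 ONE-POINT menu of the pair-sourced `t–t'` torus `A_L = dWaveSourceTorusTT' L tp U μ h`
(objective `Re ω(Φ₀ + Φ₀ᴴ)`, `onePointPairWord`; MIN with ground-state rows = a FLOOR, MAX = a CEILING) delivers
the ground-state cells `SourcedTorusCorrLowerRowGS / UpperRowGS L tp U μ h r _ hInj {1} onePointPairWord`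
(`Rows/SourcedTorusRows`; hooks `Rows/SourcedTorusRowsHook`, `Rows/SourcedTorusRowsWindowHook`, and the KKT
hook), which speak about EVERY unit `S^z`-eigenvector ground-state vector `ψ`:
`r·L² ≤ Re ⟨ψ, (Δ_d + Δ_dᴴ) ψ⟩` (`SourcedTorusCorrLowerRowGS.onePoint_iff`). The response of record
`m_L(h) = dWaveSourceDensityTT' L tp U μ h = Re ω₀(Δ_d)/L²` (`PinningFieldPairingOrder`) is the TRACIAL
ground-state expectation. This file closes the gap:

* §1 `S^z` is a real diagonal charge conserved by `A_L` and by `Δ_d + Δ_dᴴ` (`spinZ_eq_diagonal_ofReal`,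
  `dWaveSourceTorusTT'_mul_spinZ_diagonal`, `pairField_add_conjTranspose_mul_spinZ_diagonal`).
* §2 ONE TORUS: the lower cell gives `r·L² ≤ Re ω₀(Δ_d + Δ_dᴴ) = 2·L²·m_L(h)`
  (`Literature.….le_re_groundStateFunctional_of_forall_fiber`: sector-wise ground-state bounds pass to the
  tracial state), i.e. `SourcedTorusCorrLowerRowGS … r … onePointPairWord → PinFieldTorusResponseFloor L tp U μ h (r/2)`
  (`SourcedTorusCorrLowerRowGS.pinFieldTorusResponseFloor`); the upper cell gives the CEILING twin.
* §3 UNIFORM: `SourcedCorrLowerRowGS tp U μ h q L₀ r _ {1} onePointPairWord → PinFieldResponseFloorAt tp U μ h q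
  (max L₀ 3) (r/2)` (`x ↦ x mod L` is injective on the pair region for `L ≥ 3`), and the ceiling twin — the
  leaves read by `PinningFieldMenuReaders` (`.le_liminf`, `.le_pinningFieldPairingOrder`, `.dWaveOrderParameterTT'_le`).

So a one-point K5 certificate (any admissible row family: SOS, commutators, affine `D₄`, `S^z`-charged words,
KKT blocks) is, through the cells, a named floor/ceiling on `m_L(h)` on every large torus — the slot the
finite-`h` Koma–Tasaki / Kennedy–Lieb–Shastry-type levers consume. Units: `m_L` is HALF of Koma–Tasaki's
`ω(O_Λ)/|Λ|` (`O = Δ_d + Δ_dᴴ`), hence the factor `2`. NOTHING IS ASSERTED: cells in, leaves out; no certificate,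
no number, no `sorry`, no named fact. Interface note: elaborated under the torus files' local
`DecidableEq (FermionTorus 2 L)` instance (as `Rows/SourcedTorusRows[Hook]`); the response `dWaveSourceDensityTT'`
(library instance) is met through `two_mul_sq_mul_dWaveSourceDensityTT'_eq` (the tracial functional does not depend on the instance, `groundStateFunctional_eq_of_subsingleton_inst`).

References: T. Koma, H. Tasaki, J. Stat. Phys. 76 (1994) 745, §1; X. Han, arXiv:2006.06002, §3;
O. Bratteli, D. W. Robinson II §5.3.1; J. Wang et al., PRX 14 (2024) 031006, §III.
-/

noncomputable section

namespace Summit.Ventures.CertifiedManyBodySolver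

open Literature.MathematicalPhysics.QuantumLattice
open Matrix HubbardWave0 Literature.Probability.LatticeModels Finset
open Summit.Ventures.CertifiedManyBodySolver.Observables
open scoped BigOperators ComplexOrder

/-- The tracial ground-state functional does not depend on the `DecidableEq` instance of the index type
(the instances form a subsingleton) — used once, to meet the library-instance `dWaveSourceDensityTT'`. (Same
statement as `Summit.HubbardSuperconductivity.HubbardSuperconductivity.Theorems.groundStateFunctional_congr_decEq`
of `LogColdTorusAverageToEveryBlockTrace.lean`, restated for the Ventures tree, which does not import that summit.) -/
theorem groundStateFunctional_eq_of_subsingleton_inst {n : Type*} [Fintype n] (i₁ i₂ : DecidableEq n)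
    (A O : Matrix n n ℂ) :
    @Matrix.groundStateFunctional n _ i₁ A O = @Matrix.groundStateFunctional n _ i₂ A O := by
  have h : i₁ = i₂ := Subsingleton.elim _ _
  subst h
  rfl

/-- (Local to this file, as in `Rows/SourcedTorusRows` and `Rows/SourcedTorusRowsHook`, so that the cells are met
LITERALLY.) -/
local instance (priority := high) instDecidableEqFermionTorusSourcedDensityBridge {L : ℕ} :
    DecidableEq (FermionTorus 2 L) :=
  LinearOrder.toDecidableEq

/-! ## §1  `S^z` as a real diagonal charge of the sourced torus and of the pair operator -/

section Charge

variable {Λ : Type*} [LinearOrder Λ] [Fintype Λ]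

/-- `S^z = diagonal ((N↑(s) − N↓(s))/2)` with REAL diagonal entries cast to `ℂ` (the shape of
`Literature.….GroundStateSectorAverage`; from `LiebThm1.spinZ_eq_diagonal`). -/
theorem spinZ_eq_diagonal_ofReal :
    (HubbardWave0.spinZ : Matrix (Finset (Orb Λ)) (Finset (Orb Λ)) ℂ) =
      diagonal fun s => ((((((upPart s).card : ℕ) : ℝ) - (((downPart s).card : ℕ) : ℝ)) / 2 : ℝ) : ℂ) := by
  rw [LiebThm1.spinZ_eq_diagonal]
  congr 1
  funext s
  push_cast
  ring

/-- An eigenvector of the real diagonal form of `S^z` lies in `fockSpinZSector M`. -/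
theorem mem_fockSpinZSector_of_diagonal_mulVec {M : ℝ} {φ : Fock (Orb Λ)}
    (hD : (diagonal fun s : Finset (Orb Λ) =>
        ((((((upPart s).card : ℕ) : ℝ) - (((downPart s).card : ℕ) : ℝ)) / 2 : ℝ) : ℂ)) *ᵥ φ = ((M : ℝ) : ℂ) • φ) :
    φ ∈ fockSpinZSector (Λ := Λ) M := by
  rw [mem_fockSpinZSector_iff, spinZ_eq_diagonal_ofReal]
  exact hD

variable {L : ℕ} [NeZero L]

/-- The sourced `t–t'` torus Hamiltonian commutes with the diagonal charge `S^z`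
(`spinZ_mul_dWaveSourceTorusTT'`). -/
theorem dWaveSourceTorusTT'_mul_spinZ_diagonal (tp U μ h : ℝ) :
    dWaveSourceTorusTT' L tp U μ h *
        (diagonal fun s : Finset (Orb (FermionTorus 2 L)) =>
          ((((((upPart s).card : ℕ) : ℝ) - (((downPart s).card : ℕ) : ℝ)) / 2 : ℝ) : ℂ)) =
      (diagonal fun s : Finset (Orb (FermionTorus 2 L)) =>
          ((((((upPart s).card : ℕ) : ℝ) - (((downPart s).card : ℕ) : ℝ)) / 2 : ℝ) : ℂ)) *
        dWaveSourceTorusTT' L tp U μ h := by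
  rw [← spinZ_eq_diagonal_ofReal]
  exact (spinZ_mul_dWaveSourceTorusTT' (L := L) tp U μ h).symm

/-- The Hermitian pair operator `Δ_d + Δ_dᴴ` commutes with the diagonal charge `S^z` (the singlet pair
carries no `S^z`, `spinZ_commute_localPair`). -/
theorem pairField_add_conjTranspose_mul_spinZ_diagonal :
    (pairField dWaveFormFactor L + (pairField dWaveFormFactor L)ᴴ) *
        (diagonal fun s : Finset (Orb (FermionTorus 2 L)) =>
          ((((((upPart s).card : ℕ) : ℝ) - (((downPart s).card : ℕ) : ℝ)) / 2 : ℝ) : ℂ)) =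
      (diagonal fun s : Finset (Orb (FermionTorus 2 L)) =>
          ((((((upPart s).card : ℕ) : ℝ) - (((downPart s).card : ℕ) : ℝ)) / 2 : ℝ) : ℂ)) *
        (pairField dWaveFormFactor L + (pairField dWaveFormFactor L)ᴴ) := by
  rw [← spinZ_eq_diagonal_ofReal]
  have hΔ : Commute HubbardWave0.spinZ (pairField dWaveFormFactor L) :=
    Commute.sum_right _ _ _ fun x _ => spinZ_commute_localPair dWaveFormFactor L x
  have hΔ' : Commute HubbardWave0.spinZ (pairField dWaveFormFactor L)ᴴ := by
    have h1 := congrArg conjTranspose hΔ.eq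
    rw [conjTranspose_mul, conjTranspose_mul, HubbardWave0.spinZ_isHermitian.eq] at h1
    exact h1.symm
  exact (hΔ.add_right hΔ').symm.eq

end Charge

/-! ## §2  One torus: the one-point ground-state cell bounds the tracial response `m_L(h)` -/

section OneTorus

variable {L : ℕ} [NeZero L] {tp U μ h : ℝ} {r : ℚ}

/-- **Units**: `2·L²·m_L(h) = Re ω₀(Δ_d + Δ_dᴴ)` — `m_L = dWaveSourceDensityTT' = Re ω₀(Δ_d)/L²` is half of
Koma–Tasaki's `ω(O_Λ)/|Λ|`. (The library-instance `dWaveSourceDensityTT'` against this file's local instance: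
the instance arguments agree by `Subsingleton.elim`, `congr!`.) -/
theorem two_mul_sq_mul_dWaveSourceDensityTT'_eq (L : ℕ) [NeZero L] (tp U μ h : ℝ) :
    2 * (L : ℝ) ^ 2 * dWaveSourceDensityTT' L tp U μ h =
      ((dWaveSourceTorusTT' L tp U μ h).groundStateFunctional
        (pairField dWaveFormFactor L + (pairField dWaveFormFactor L)ᴴ)).re := by
  have hL : ((L : ℝ)) ^ 2 ≠ 0 := pow_ne_zero 2 (Nat.cast_ne_zero.2 (NeZero.ne L))
  have hdef : dWaveSourceDensityTT' L tp U μ h =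
      ((dWaveSourceTorusTT' L tp U μ h).groundStateFunctional (pairField dWaveFormFactor L)).re / (L : ℝ) ^ 2 := by
    unfold dWaveSourceDensityTT'
    rw [groundStateFunctional_eq_of_subsingleton_inst]
  rw [hdef, map_add, Complex.add_re, groundStateFunctional_conjTranspose_re, mul_assoc, mul_div_assoc',
    mul_div_cancel_left₀ _ hL, two_mul]

/-- **The one-point LOWER ground-state cell bounds the tracial response from below**:
`SourcedTorusCorrLowerRowGS L tp U μ h r _ hInj {1} onePointPairWord → r·L² ≤ Re ω₀(Δ_d + Δ_dᴴ)`.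
The cell holds for every `S^z`-eigenvector ground state; `S^z` is a diagonal charge conserved by `A_L` and by
`Δ_d + Δ_dᴴ`, so the bound passes to every ground-state vector and to the tracial state
(`le_re_groundStateFunctional_of_forall_fiber`). -/
theorem SourcedTorusCorrLowerRowGS.onePoint_le_re_groundStateFunctional
    (hInj : Set.InjOn (Torus.proj (d := 2) L) ↑(pairRegion (insert (0 : Site 2) unitSteps) 0))
    (hrow : SourcedTorusCorrLowerRowGS L tp U μ h r _ hInj ({1} : Finset (DihedralGroup 4)) onePointPairWord) :
    ((r : ℚ) : ℝ) * (L : ℝ) ^ 2 ≤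
      ((dWaveSourceTorusTT' L tp U μ h).groundStateFunctional
        (pairField dWaveFormFactor L + (pairField dWaveFormFactor L)ᴴ)).re := by
  have hcell := (SourcedTorusCorrLowerRowGS.onePoint_iff hInj).1 hrow
  exact le_re_groundStateFunctional_of_forall_fiber (dWaveSourceTorusTT'_isHermitian L tp U μ h)
    (dWaveSourceTorusTT'_mul_spinZ_diagonal tp U μ h) pairField_add_conjTranspose_mul_spinZ_diagonal
    fun M φ hD h1 hgs => hcell M φ (mem_fockSpinZSector_of_diagonal_mulVec hD) h1 hgs

/-- **The one-point UPPER ground-state cell bounds the tracial response from above**: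
`SourcedTorusCorrUpperRowGS … r … onePointPairWord → Re ω₀(Δ_d + Δ_dᴴ) ≤ r·L²`. -/
theorem SourcedTorusCorrUpperRowGS.onePoint_re_groundStateFunctional_le
    (hInj : Set.InjOn (Torus.proj (d := 2) L) ↑(pairRegion (insert (0 : Site 2) unitSteps) 0))
    (hrow : SourcedTorusCorrUpperRowGS L tp U μ h r _ hInj ({1} : Finset (DihedralGroup 4)) onePointPairWord) :
    ((dWaveSourceTorusTT' L tp U μ h).groundStateFunctional
        (pairField dWaveFormFactor L + (pairField dWaveFormFactor L)ᴴ)).re ≤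
      ((r : ℚ) : ℝ) * (L : ℝ) ^ 2 := by
  have hcell := (SourcedTorusCorrUpperRowGS.onePoint_iff hInj).1 hrow
  exact re_groundStateFunctional_le_of_forall_fiber (dWaveSourceTorusTT'_isHermitian L tp U μ h)
    (dWaveSourceTorusTT'_mul_spinZ_diagonal tp U μ h) pairField_add_conjTranspose_mul_spinZ_diagonal
    fun M φ hD h1 hgs => hcell M φ (mem_fockSpinZSector_of_diagonal_mulVec hD) h1 hgs

/-- **One-point LOWER cell ⇒ response FLOOR cell on the same torus**: `r/2 ≤ m_L(h)`, i.e.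
`PinFieldTorusResponseFloor L tp U μ h (r/2)` (`Observables/PinningFieldChords`). [cite: KomaTasaki1994, §1] -/
theorem SourcedTorusCorrLowerRowGS.pinFieldTorusResponseFloor
    (hInj : Set.InjOn (Torus.proj (d := 2) L) ↑(pairRegion (insert (0 : Site 2) unitSteps) 0))
    (hrow : SourcedTorusCorrLowerRowGS L tp U μ h r _ hInj ({1} : Finset (DihedralGroup 4)) onePointPairWord) :
    PinFieldTorusResponseFloor L tp U μ h (r / 2) := by
  unfold PinFieldTorusResponseFloor
  have hL : (0 : ℝ) < (L : ℝ) ^ 2 := by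
    have : (0 : ℝ) < (L : ℝ) := by exact_mod_cast Nat.pos_of_ne_zero (NeZero.ne L)
    positivity
  have hb := hrow.onePoint_le_re_groundStateFunctional hInj
  rw [← two_mul_sq_mul_dWaveSourceDensityTT'_eq L tp U μ h] at hb
  push_cast
  nlinarith

/-- **One-point UPPER cell ⇒ response CEILING cell on the same torus**: `m_L(h) ≤ r/2`, i.e.
`PinFieldTorusResponseCeiling L tp U μ h (r/2)`. [cite: KomaTasaki1994, §1] -/
theorem SourcedTorusCorrUpperRowGS.pinFieldTorusResponseCeiling
    (hInj : Set.InjOn (Torus.proj (d := 2) L) ↑(pairRegion (insert (0 : Site 2) unitSteps) 0))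
    (hrow : SourcedTorusCorrUpperRowGS L tp U μ h r _ hInj ({1} : Finset (DihedralGroup 4)) onePointPairWord) :
    PinFieldTorusResponseCeiling L tp U μ h (r / 2) := by
  unfold PinFieldTorusResponseCeiling
  have hL : (0 : ℝ) < (L : ℝ) ^ 2 := by
    have : (0 : ℝ) < (L : ℝ) := by exact_mod_cast Nat.pos_of_ne_zero (NeZero.ne L)
    positivity
  have hb := hrow.onePoint_re_groundStateFunctional_le hInj
  rw [← two_mul_sq_mul_dWaveSourceDensityTT'_eq L tp U μ h] at hb
  push_cast
  nlinarith

/-- The below-cap one-point LOWER cell at cap `u` together with an energy CEILING cell at the same `u` gives the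
response floor `r/2 ≤ m_L(h)` (`gs_of_energyUpperRow`, then `pinFieldTorusResponseFloor`). [cite: KomaTasaki1994, §1] -/
theorem SourcedTorusCorrLowerRow.pinFieldTorusResponseFloor_of_energyUpperRow {u : ℚ}
    (hInj : Set.InjOn (Torus.proj (d := 2) L) ↑(pairRegion (insert (0 : Site 2) unitSteps) 0))
    (hrow : SourcedTorusCorrLowerRow L tp U μ h u r _ hInj ({1} : Finset (DihedralGroup 4)) onePointPairWord)
    (hE : SourcedTorusEnergyUpperRow L tp U μ h u) :
    PinFieldTorusResponseFloor L tp U μ h (r / 2) :=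
  (hrow.gs_of_energyUpperRow hE).pinFieldTorusResponseFloor hInj

/-- The below-cap one-point UPPER cell at cap `u` with an energy CEILING cell at `u` gives `m_L(h) ≤ r/2`.
[cite: KomaTasaki1994, §1] -/
theorem SourcedTorusCorrUpperRow.pinFieldTorusResponseCeiling_of_energyUpperRow {u : ℚ}
    (hInj : Set.InjOn (Torus.proj (d := 2) L) ↑(pairRegion (insert (0 : Site 2) unitSteps) 0))
    (hrow : SourcedTorusCorrUpperRow L tp U μ h u r _ hInj ({1} : Finset (DihedralGroup 4)) onePointPairWord)
    (hE : SourcedTorusEnergyUpperRow L tp U μ h u) :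
    PinFieldTorusResponseCeiling L tp U μ h (r / 2) :=
  (hrow.gs_of_energyUpperRow hE).pinFieldTorusResponseCeiling hInj

end OneTorus

/-! ## §3  Uniform in `L`: the one-point cells are the response leaves `PinFieldResponseFloorAt / CeilingAt` -/

section Uniform

/-- The pair region `{0} ∪ ({0} + ({0} ∪ {±e₁, ±e₂}))` lies in `[-1,1]²`. (Adapted from the private
`pairRegion_insert_zero_unitSteps_subset_thicken` of `Literature.….PairSourcedTorusLimitResponse`.) -/
theorem pairRegion_insert_zero_unitSteps_subset_thicken_one :
    pairRegion (insert (0 : Site 2) unitSteps) 0 ⊆ thicken ({0} : Finset (Site 2)) 1 := by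
  intro z hz
  rw [pairRegion, Finset.mem_insert, Finset.mem_image] at hz
  rcases hz with rfl | ⟨e, he, rfl⟩
  · exact zero_mem_thicken_zero 1
  · rw [zero_add]
    rw [Finset.mem_insert] at he
    rcases he with rfl | he
    · exact zero_mem_thicken_zero 1
    · simp only [unitSteps, Finset.mem_insert, Finset.mem_singleton] at he
      rcases he with rfl | rfl | rfl | rfl
      · exact unitVec_mem_thicken_one 0
      · exact neg_unitVec_mem_thicken_one 0
      · exact unitVec_mem_thicken_one 1
      · exact neg_unitVec_mem_thicken_one 1

/-- For `L ≥ 3` the one-point window fits into the torus: `x ↦ x mod L` is injective on the pair region. -/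
theorem injOn_proj_pairRegion_of_three_le {L : ℕ} (hL : 3 ≤ L) :
    Set.InjOn (Torus.proj (d := 2) L) ↑(pairRegion (insert (0 : Site 2) unitSteps) 0) :=
  (injOn_proj_thicken_one (d := 2) hL).mono (Finset.coe_subset.2 pairRegion_insert_zero_unitSteps_subset_thicken_one)

variable {tp U μ h : ℝ} {q L₀ : ℕ} {u r : ℚ}

/-- **Uniform one-point LOWER ground-state cell ⇒ the response FLOOR leaf**:
`SourcedCorrLowerRowGS tp U μ h q L₀ r _ {1} onePointPairWord → PinFieldResponseFloorAt tp U μ h q (max L₀ 3) (r/2)`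
— `r/2 ≤ m_L(h)` on every side `L ≥ max L₀ 3` with `q ∣ L`; read on by `PinFieldResponseFloorAt.le_liminf`,
`.le_pinningFieldPairingOrder` (`Observables/PinningFieldMenuReaders`). [cite: KomaTasaki1994, §1] -/
theorem SourcedCorrLowerRowGS.pinFieldResponseFloorAt
    (hrow : SourcedCorrLowerRowGS tp U μ h q L₀ r (pairRegion (insert (0 : Site 2) unitSteps) 0)
      ({1} : Finset (DihedralGroup 4)) onePointPairWord) :
    PinFieldResponseFloorAt tp U μ h q (max L₀ 3) (r / 2) := by
  intro L _ hL hqL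
  have hInj := injOn_proj_pairRegion_of_three_le (le_trans (le_max_right _ _) hL)
  exact (hrow L hInj (le_trans (le_max_left _ _) hL) hqL).pinFieldTorusResponseFloor hInj

/-- **Uniform one-point UPPER ground-state cell ⇒ the response CEILING leaf**:
`SourcedCorrUpperRowGS … r … onePointPairWord → PinFieldResponseCeilingAt tp U μ h q (max L₀ 3) (r/2)`; read on by
`PinFieldResponseCeilingAt.limsup_le`, `.dWaveOrderParameterTT'_le`. [cite: KomaTasaki1994, §1] -/
theorem SourcedCorrUpperRowGS.pinFieldResponseCeilingAt
    (hrow : SourcedCorrUpperRowGS tp U μ h q L₀ r (pairRegion (insert (0 : Site 2) unitSteps) 0)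
      ({1} : Finset (DihedralGroup 4)) onePointPairWord) :
    PinFieldResponseCeilingAt tp U μ h q (max L₀ 3) (r / 2) := by
  intro L _ hL hqL
  have hInj := injOn_proj_pairRegion_of_three_le (le_trans (le_max_right _ _) hL)
  exact (hrow L hInj (le_trans (le_max_left _ _) hL) hqL).pinFieldTorusResponseCeiling hInj

/-- **Below-cap one-point LOWER cell + uniform energy CEILING cell at the same cap ⇒ response FLOOR leaf** on the
common sides (`q' = q`, side threshold `max (max L₀ L₀') 3`). [cite: KomaTasaki1994, §1] -/
theorem SourcedCorrLowerRow.pinFieldResponseFloorAt_of_energyUpperRow {L₀' : ℕ}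
    (hrow : SourcedCorrLowerRow tp U μ h q L₀ u r (pairRegion (insert (0 : Site 2) unitSteps) 0)
      ({1} : Finset (DihedralGroup 4)) onePointPairWord)
    (hE : SourcedEnergyUpperRow tp U μ h q L₀' u) :
    PinFieldResponseFloorAt tp U μ h q (max (max L₀ L₀') 3) (r / 2) :=
  (hrow.gs_of_energyUpperRow hE (dvd_refl q)).pinFieldResponseFloorAt

/-- **Below-cap one-point UPPER cell + uniform energy CEILING cell ⇒ response CEILING leaf**. [cite: KomaTasaki1994, §1] -/
theorem SourcedCorrUpperRow.pinFieldResponseCeilingAt_of_energyUpperRow {L₀' : ℕ}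
    (hrow : SourcedCorrUpperRow tp U μ h q L₀ u r (pairRegion (insert (0 : Site 2) unitSteps) 0)
      ({1} : Finset (DihedralGroup 4)) onePointPairWord)
    (hE : SourcedEnergyUpperRow tp U μ h q L₀' u) :
    PinFieldResponseCeilingAt tp U μ h q (max (max L₀ L₀') 3) (r / 2) :=
  (hrow.gs_of_energyUpperRow hE (dvd_refl q)).pinFieldResponseCeilingAt

/-- **Both one-point cells ⇒ the two-sided response WINDOW leaf** `m_L(h) ∈ [r/2, r'/2]` on the common sides.
[cite: KomaTasaki1994, §1] -/
theorem SourcedCorrLowerRowGS.pinFieldResponseWindowAt {r' : ℚ} {L₀' : ℕ}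
    (hlo : SourcedCorrLowerRowGS tp U μ h q L₀ r (pairRegion (insert (0 : Site 2) unitSteps) 0)
      ({1} : Finset (DihedralGroup 4)) onePointPairWord)
    (hhi : SourcedCorrUpperRowGS tp U μ h q L₀' r' (pairRegion (insert (0 : Site 2) unitSteps) 0)
      ({1} : Finset (DihedralGroup 4)) onePointPairWord) :
    PinFieldResponseWindowAt tp U μ h q (max (max L₀ L₀') 3) (r / 2) (r' / 2) :=
  ⟨hlo.pinFieldResponseFloorAt.mono le_rfl (max_le_max (le_max_left _ _) le_rfl) dvd_rfl,
    hhi.pinFieldResponseCeilingAt.mono le_rfl (max_le_max (le_max_right _ _) le_rfl) dvd_rfl⟩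

end Uniform

end Summit.Ventures.CertifiedManyBodySolver

end
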